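import Summits.FinalStateConjecture.FinalStateConjecture.Theorems.BartnikGapSettlingBondiBartnikRigidityMarchingLemmaCollarSetBasic
import Summits.FinalStateConjecture.FinalStateConjecture.Theorems.BartnikGapSettlingBondiBartnikRigidityMarchingLemmaRadiusLipschitz
import Literature.Geometry.Lorentzian.CoordSlice
import HarnessLib

/-!
# K2b-5 `stub_marchingLemma`, brick 16: the covering lemma of the marching — line
# `direct-method-on-the-cone` (crux `BondiBartnikRigidity`, stmt-FinalStateConjecture-10807)

`exists_frontier_near_of_not_upper` (report K2b-a2 §4, "W ∩ {τ ≤ t* < τ + h} ⊆ K ∪ F"): a point `x` of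
`W = J⁺_K(slab)°` with `σ ≤ t*(x) < σ + h` which is NOT in the upper kite over the level `σ` (its
backward coordinate cone of slope `1`, cut at the hole clock, does not rest on the level set
`{z : (σ, z) ∈ W}`) is `2h`-close to a ROOF point `z ∈ ∂J⁺_K(slab)` with `σ ≤ t*(z) ≤ t*(x)` and
`3M ≤ r(z) ≤ r(x) + 4h`.  Proof: the bad base point `q = (σ, z₀)` of the cone is a chart point off `W`
with `r(q) ≥ 3M` (the open cylinder is inside `W`); the coordinate segment from `x` to `q` stays in the
chart (`r` is `2`-Lipschitz, `RadiusK.abs_radius_segment_sub_le`) and crosses `∂W ⊆ ∂J⁺_K(slab)` at a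
point `z`, which is not a slab point (`t*(z) ≥ σ > 0`), hence a roof point (`SlabFrontier`), so
`r(z) ≥ 3M` (`CollarK.radius_ge_of_mem_roofK`).

References: Dafermos–Rodnianski arXiv:0811.0354, §5.1 [DafermosRodnianski2008]; Hawking–Ellis 1973, §6.3
[HawkingEllis1973CUP].  No definitions, no named facts.
-/

noncomputable section

-- D-0017: single-problem summit, `Summit.<S>.<S>.…` by design (cf. lakefile `weak.linter.dupNamespace`).
set_option linter.dupNamespace false
set_option maxSynthPendingDepth 3

open Set Filter Function Topology TopologicalSpace Metric
open Literature.Geometry.Lorentzian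
open scoped Topology

namespace Summit.FinalStateConjecture.FinalStateConjecture.Theorems.BondiBartnikRigidity.DirectMethod

namespace CoverK

variable [Kerr.Facts] {M a : ℝ}

/-- **The covering lemma** (see the module docstring). [cite: DafermosRodnianski2008, §5.1] -/
theorem exists_frontier_near_of_not_upper (hM : 0 < M) (ha : |a| < M)
    (hcyl : {y : Kerr.region a M | 0 ≤ y.1 0 ∧ Kerr.radius a y.1 ≤ 3 * M} ⊆ JK M a hM (slabK M a))
    (hfr : frontier (JK M a hM (slabK M a)) ⊆ slabK M a ∪ JK M a hM (outerSphereK M a))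
    {σ h : ℝ} (hσ : 0 < σ) (hh : 0 < h) (hhM : 4 * h < M) {N : Set E3}
    (hN : ∀ z : E3, (∃ hz : E4.ofTimeSpace σ z ∈ Kerr.region a M,
      (⟨E4.ofTimeSpace σ z, hz⟩ : Kerr.region a M) ∈ interior (JK M a hM (slabK M a))) → z ∈ N)
    {x : Kerr.region a M} (hxW : x ∈ interior (JK M a hM (slabK M a))) (hx1 : σ ≤ x.1 0) (hx2 : x.1 0 < σ + h)
    (hnot : ¬ ∀ z : E3, ‖z - E4.spatial x.1‖ ≤ x.1 0 - σ →
      min (Kerr.radius a x.1) (Kerr.rPlus M a) ≤ Kerr.radius a (E4.ofTimeSpace 0 z) → z ∈ N) :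
    ∃ z ∈ frontier (JK M a hM (slabK M a)), σ ≤ z.1 0 ∧ z.1 0 ≤ x.1 0 ∧ 3 * M ≤ Kerr.radius a z.1 ∧
      Kerr.radius a z.1 ≤ Kerr.radius a x.1 + 4 * h ∧ dist x z ≤ 2 * h := by
  push Not at hnot
  obtain ⟨z₀, hd, hrz₀, hz₀N⟩ := hnot
  set d := ‖z₀ - E4.spatial x.1‖ with hd_def
  have hdh : d < h := by linarith
  have hrP : M < Kerr.rPlus M a := F1Route.self_lt_rPlus ha
  have hxr : M < Kerr.radius a x.1 := Kerr.lt_radius_of_mem_region x.2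
  have hmin : M < min (Kerr.radius a x.1) (Kerr.rPlus M a) := lt_min hxr hrP
  -- the bad base point `q = (σ, z₀)`
  have hq0 : Kerr.radius a (E4.ofTimeSpace σ z₀) = Kerr.radius a (E4.ofTimeSpace 0 z₀) :=
    Kerr.radius_eq_of_spatial_eq a (by rw [E4.spatial_ofTimeSpace, E4.spatial_ofTimeSpace])
  have hmax : max M 0 = M := max_eq_left hM.le
  have hqreg : E4.ofTimeSpace σ z₀ ∈ Kerr.region a M := by
    rw [Kerr.mem_region, hmax, hq0]; linarith
  set q : Kerr.region a M := ⟨E4.ofTimeSpace σ z₀, hqreg⟩ with hq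
  have hqW : q ∉ interior (JK M a hM (slabK M a)) := fun h' => hz₀N (hN z₀ ⟨hqreg, h'⟩)
  have hq3 : 3 * M ≤ Kerr.radius a (E4.ofTimeSpace 0 z₀) := by
    by_contra hlt
    push Not at hlt
    have hO : IsOpen {y : Kerr.region a M | 0 < y.1 0 ∧ Kerr.radius a y.1 < 3 * M} :=
      (isOpen_lt continuous_const (K2Route.continuous_tstar a M)).inter
        (isOpen_lt (K2Route.continuous_radius_region a M) continuous_const)
    refine hqW (interior_maximal (fun y hy => hcyl ⟨hy.1.le, hy.2.le⟩) hO ⟨?_, ?_⟩)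
    · show 0 < (E4.ofTimeSpace σ z₀) 0; rw [E4.ofTimeSpace_apply_zero]; exact hσ
    · show Kerr.radius a (E4.ofTimeSpace σ z₀) < 3 * M; rw [hq0]; exact hlt
  -- `r` along the spatial segment from `z₀` to `x̂`
  have haM : |a| < M := ha
  have hlip := RadiusK.abs_radius_segment_sub_le (a := a) (y := z₀) (y' := E4.spatial x.1)
    (by rw [show ‖E4.spatial x.1 - z₀‖ = d by rw [hd_def, norm_sub_rev]]; linarith)
  have hxr0 : Kerr.radius a x.1 = Kerr.radius a (E4.ofTimeSpace 0 (E4.spatial x.1)) :=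
    (Kerr.radius_ofTimeSpace_spatial a x.1).symm
  have hrx : |Kerr.radius a x.1 - Kerr.radius a (E4.ofTimeSpace 0 z₀)| ≤ 2 * d := by
    have := hlip 1 ⟨zero_le_one, le_rfl⟩
    rw [one_smul, add_sub_cancel, ← hxr0, show ‖E4.spatial x.1 - z₀‖ = d by rw [hd_def, norm_sub_rev]] at this
    linarith
  -- the coordinate segment `p μ = q + μ (x − q)` (so `p 0 = q`, `p 1 = x`), clamped to `[0, 1]`
  set p : ℝ → E4 := fun μ => q.1 + μ • (x.1 - q.1) with hp
  have hpsp : ∀ μ, E4.spatial (p μ) = z₀ + μ • (E4.spatial x.1 - z₀) := fun μ => by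
    simp only [hp, map_add, map_smul, map_sub, hq, E4.spatial_ofTimeSpace]
  have hpt : ∀ μ, p μ 0 = σ + μ * (x.1 0 - σ) := fun μ => by
    simp [hp, hq, E4.ofTimeSpace_apply_zero]
  have hpr : ∀ μ ∈ Icc (0 : ℝ) 1, |Kerr.radius a (p μ) - Kerr.radius a (E4.ofTimeSpace 0 z₀)| ≤ 2 * μ * d ∧
      p μ ∈ Kerr.region a M := by
    intro μ hμ
    have h1 := hlip μ hμ
    rw [show ‖E4.spatial x.1 - z₀‖ = d by rw [hd_def, norm_sub_rev]] at h1
    have h2 : Kerr.radius a (p μ) = Kerr.radius a (E4.ofTimeSpace 0 (z₀ + μ • (E4.spatial x.1 - z₀))) := by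
      rw [← hpsp μ]; exact (Kerr.radius_ofTimeSpace_spatial a (p μ)).symm
    rw [Kerr.mem_region, hmax, h2]
    refine ⟨h1, ?_⟩
    have := neg_abs_le (Kerr.radius a (E4.ofTimeSpace 0 (z₀ + μ • (E4.spatial x.1 - z₀))) -
      Kerr.radius a (E4.ofTimeSpace 0 z₀))
    nlinarith [hμ.2, hμ.1]
  set γ : ℝ → Kerr.region a M := fun μ => ⟨p (max 0 (min μ 1)), (hpr _ ⟨le_max_left _ _,
    max_le zero_le_one (min_le_right _ _)⟩).2⟩ with hγ
  have hγc : Continuous γ := by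
    refine Continuous.subtype_mk ?_ _
    exact (continuous_const.add ((continuous_const.max (continuous_id.min continuous_const)).smul
      continuous_const))
  have hγeq : ∀ μ ∈ Icc (0 : ℝ) 1, (γ μ).1 = p μ := fun μ hμ => by
    simp only [hγ]; rw [min_eq_left hμ.2, max_eq_right hμ.1]
  have hγ0 : γ 0 = q := Subtype.ext (by rw [hγeq 0 ⟨le_rfl, zero_le_one⟩]; simp [hp])
  have hγ1 : γ 1 = x := Subtype.ext (by rw [hγeq 1 ⟨zero_le_one, le_rfl⟩]; simp [hp])
  -- the LAST parameter off `W` along the segment from `q` (`μ = 0`) to `x` (`μ = 1`)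
  set X : Set ℝ := {μ ∈ Icc (0 : ℝ) 1 | γ μ ∉ interior (JK M a hM (slabK M a))} with hX
  have hXc : IsClosed X := isClosed_Icc.inter ((isOpen_interior.preimage hγc).isClosed_compl)
  have h0X : (0 : ℝ) ∈ X := ⟨⟨le_rfl, zero_le_one⟩, by rw [hγ0]; exact hqW⟩
  have hbdd : BddAbove X := ⟨1, fun μ hμ => hμ.1.2⟩
  set μ₀ := sSup X with hμ₀
  have hμ₀X : μ₀ ∈ X := hXc.csSup_mem ⟨0, h0X⟩ hbdd
  have hμ₀I : μ₀ ∈ Icc (0 : ℝ) 1 := hμ₀X.1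
  have hμ₀1 : μ₀ < 1 := lt_of_le_of_ne hμ₀I.2 fun h1 => hμ₀X.2 (by rw [h1, hγ1]; exact hxW)
  have habove : ∀ μ, μ₀ < μ → μ ≤ 1 → γ μ ∈ interior (JK M a hM (slabK M a)) := fun μ hμ hμ1 => by
    by_contra hc
    exact absurd (le_csSup hbdd ⟨⟨hμ₀I.1.trans hμ.le, hμ1⟩, hc⟩) (not_le.2 hμ)
  -- `z = γ μ₀` is a frontier point of `W`, hence of `J⁺_K(slab)`
  set z := γ μ₀ with hz
  have hzcl : z ∈ closure (interior (JK M a hM (slabK M a))) := by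
    have ht : Tendsto γ (𝓝[>] μ₀) (𝓝 z) := hγc.continuousAt.tendsto.mono_left nhdsWithin_le_nhds
    refine mem_closure_of_tendsto ht ?_
    filter_upwards [Ioo_mem_nhdsGT hμ₀1] with μ hμ
    exact habove μ hμ.1 hμ.2.le
  have hzfrW : z ∈ frontier (interior (JK M a hM (slabK M a))) := by
    rw [frontier, interior_interior]; exact ⟨hzcl, hμ₀X.2⟩
  have hzfr : z ∈ frontier (JK M a hM (slabK M a)) := frontier_interior_subset hzfrW
  -- coordinates of `z`
  have hz1 : z.1 = p μ₀ := hγeq μ₀ hμ₀I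
  have hzt : z.1 0 = σ + μ₀ * (x.1 0 - σ) := by rw [hz1]; exact hpt μ₀
  obtain ⟨hzr, -⟩ := hpr μ₀ hμ₀I
  rw [← hz1] at hzr
  have hzσ : σ ≤ z.1 0 := by rw [hzt]; nlinarith [hμ₀I.1]
  have hz3 : 3 * M ≤ Kerr.radius a z.1 := by
    refine CollarK.radius_ge_of_mem_roofK hM ha hcyl ⟨hzfr, ?_⟩
    rcases hfr hzfr with hs | hs
    · exfalso; have : z.1 0 = 0 := hs.1; linarith
    · exact hs
  refine ⟨z, hzfr, hzσ, ?_, hz3, ?_, ?_⟩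
  · rw [hzt]; nlinarith [hμ₀I.2, hμ₀I.1]
  · have h1 := abs_le.1 hzr
    have h2 := abs_le.1 hrx
    nlinarith [hμ₀I.2, hμ₀I.1]
  · -- `dist x z = (1 − μ₀) ‖x − q‖ ≤ ‖x − q‖ ≤ √2 h ≤ 2h`
    have hxq : ‖x.1 - q.1‖ ≤ 2 * h := by
      have hsq : ‖x.1 - q.1‖ ^ 2 ≤ (2 * h) ^ 2 := by
        rw [CoordSlice.norm_sq_eq]
        have ht0 : (x.1 - q.1) 0 = x.1 0 - σ := by simp [hq, E4.ofTimeSpace_apply_zero]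
        have hsp0 : E4.spatial (x.1 - q.1) = E4.spatial x.1 - z₀ := by simp [hq, E4.spatial_ofTimeSpace]
        rw [ht0, hsp0, show ‖E4.spatial x.1 - z₀‖ = d by rw [hd_def, norm_sub_rev]]
        nlinarith [norm_nonneg (z₀ - E4.spatial x.1)]
      nlinarith [norm_nonneg (x.1 - q.1)]
    rw [Subtype.dist_eq, dist_eq_norm, hz1]
    have : x.1 - p μ₀ = (1 - μ₀) • (x.1 - q.1) := by simp only [hp]; module
    rw [this, norm_smul, Real.norm_eq_abs, abs_of_nonneg (by linarith [hμ₀I.2])]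
    nlinarith [norm_nonneg (x.1 - q.1), hμ₀I.1, hμ₀I.2]

end CoverK

/-- **Registered bookkeeping sub-goal `stub_kerrLevelPointRegion` of the line** (brick of the landing of
K2b-5 `stub_marchingLemma`): a slice point whose radius dominates `min (r(x), r₊)` for a chart point `x`
is a chart point at every Kerr time (anchor of this file, whose content is the covering lemma of the
marching `CoverK.exists_frontier_near_of_not_upper`). [folklore] -/
theorem stub_kerrLevelPointRegion [Kerr.Facts] : ∀ (M a : ℝ), 0 < M → |a| < M → ∀ (x : Kerr.region a M) (z : E3) (σ : ℝ),
    min (Kerr.radius a x.1) (Kerr.rPlus M a) ≤ Kerr.radius a (E4.ofTimeSpace 0 z) →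
    E4.ofTimeSpace σ z ∈ Kerr.region a M := by
  intro M a hM ha x z σ h
  have hq0 : Kerr.radius a (E4.ofTimeSpace σ z) = Kerr.radius a (E4.ofTimeSpace 0 z) :=
    Kerr.radius_eq_of_spatial_eq a (by rw [E4.spatial_ofTimeSpace, E4.spatial_ofTimeSpace])
  rw [Kerr.mem_region, max_eq_left hM.le, hq0]
  exact lt_of_lt_of_le (lt_min (Kerr.lt_radius_of_mem_region x.2) (F1Route.self_lt_rPlus ha)) h

end Summit.FinalStateConjecture.FinalStateConjecture.Theorems.BondiBartnikRigidity.DirectMethod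

end
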